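import Literature.Geometry.Kaehler.ComplexTorusRationalFormsBasis
import Literature.Geometry.Kaehler.ComplexTorusProduct
import Literature.Geometry.Kaehler.ComplexTorusEllipticCurve
import Literature.Analysis.Complex.PQTypesPullbackProofs
import HarnessLib

/-!
# Hodge classes of products of complex tori (Künneth) and of the elliptic curve `ℂ/(ℤτ + ℤ)` — instances

Layer `Literature/Geometry/Kaehler`, namespace `Literature.Geometry.Kaehler.ComplexTorus`; lane
`lit-hodgefound`, Layer A4, row A4-20 (Künneth containment `H_Hodge(T) ⊗ H_Hodge(S) → H_Hodge(T × S)`)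
and validation rows V-A4-2 / V-A4-4 of `run/shared/lean/pub/lit-hodgefound/SKELETON.md`, on the
presentations landed by the A2 seat: the product torus `prodPeriod Φ₁ Φ₂ : ℝ^(ι₁ ⊔ ι₂) ≃ E₁ × E₂`
(`ComplexTorusProduct.lean`) and the elliptic curve `ellipticPeriod hτ : ℝ² ≃ ℂ` of the lattice
`ℤτ + ℤ` with its principal polarisation `ellipticForm` (`ComplexTorusEllipticCurve.lean`).

Sources: H. Lange, *Abelian Varieties over the Complex Numbers* (2023), held copy
`book:lange1992-complex-abelian-varieties`: §7.2.2 (Hodge classes), §7.3.3 Exercise (2)–(3)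
(Lefschetz `(1,1)`, products of elliptic curves), §2.1.1 Example 2.1.3 (the elliptic curve);
B. van Geemen, LNM 1594 (1994), §2 (`Bᵖ(X) ⊗ B^q(Y) ⊆ B^{p+q}(X × Y)` via `pr₁^* ∪ pr₂^*`);
A. Hatcher, *Algebraic Topology*, Thm. 3.16 (Künneth for tori: cross products of monomials).

## Contents (theorems only; no definition, no named fact)

* `latticeTuple_prodPeriod_fst/snd` — lattice tuples of the product project to lattice tuples;
* `comp_fst_mem_rationalForms`, `comp_snd_mem_rationalForms`, `comp_fst_mem_hodgeClassesIn`,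
  `comp_snd_mem_hodgeClassesIn` — `pr₁^*`, `pr₂^*` carry rational / Hodge classes of the factors to the
  product (the projections are `ℂ`-linear, `IsOfTypeAt.compContinuousLinearMap`);
* **`wedge_comp_fst_snd_mem_hodgeClassesIn`** — **Künneth containment** (row A4-20): for Hodge classes
  `γ ∈ H^{2p}_Hodge(X₁)`, `δ ∈ H^{2q}_Hodge(X₂)`, the cross product `pr₁^*γ ∧ pr₂^*δ` is a Hodge class of
  `X₁ × X₂` of codimension `p + q`;
* the elliptic curve `X_τ = ℂ/(ℤτ + ℤ)`: `hodgeClasses_ellipticPeriod_one_eq` (**`H²_Hodge = H²(X, ℚ)`**),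
  `finrank_hodgeClasses_ellipticPeriod_one` (**`dim_ℚ H²_Hodge(X_τ) = 1`**, V-A4-2) and
  `ellipticForm_mem_hodgeClasses` (the principal polarisation class `E = Im H`, `E(τ, 1) = 1`, is a
  Hodge class); for products `X₁ × X₂`: `prodForm_mem_hodgeClasses` (the product polarisation class
  `pr₁^*E₁ + pr₂^*E₂` is a Hodge class). (The instances `X_τ × X_{τ'}` are the specialisations
  `Φᵢ = ellipticPeriod _` of the `Product` section and are not restated.)

## References

* [Lange2023AbelianVarietiesComplex] H. Lange, *Abelian Varieties over the Complex Numbers* (2023),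
  §2.1.1 Example 2.1.3, §7.2.2, §7.3.3 Exercise (2)–(3).
* [vanGeemen1994HodgeAV] B. van Geemen, *An introduction to the Hodge conjecture for abelian
  varieties*, LNM 1594 (1994), §2.
* [HatcherAT2002] A. Hatcher, *Algebraic Topology* (2002), §3.2 Thm. 3.16.
-/

noncomputable section

open scoped Manifold ContDiff Topology Real
open Set Function Complex Finset Module
open Literature.Analysis.Complex (IsOfTypeAt)

namespace Literature.Geometry.Kaehler

namespace ComplexTorus

/-! ### Products: `pr₁^*`, `pr₂^*` and the Künneth containment -/

section Product

variable {ι₁ ι₂ : Type*} [Fintype ι₁] [Fintype ι₂] {E₁ E₂ : Type*} [NormedAddCommGroup E₁]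
  [NormedSpace ℂ E₁] [NormedAddCommGroup E₂] [NormedSpace ℂ E₂]
  (Φ₁ : (ι₁ → ℝ) ≃L[ℝ] E₁) (Φ₂ : (ι₂ → ℝ) ≃L[ℝ] E₂)

/-- Lattice vectors of the product torus are pairs of lattice vectors of the factors.
[cite: LangeBirkenhake1992, §5.3] -/
theorem latticeVec_prodPeriod (m : ι₁ ⊕ ι₂ → ℤ) :
    latticeVec (prodPeriod Φ₁ Φ₂) m =
      (latticeVec Φ₁ (fun i ↦ m (Sum.inl i)), latticeVec Φ₂ (fun j ↦ m (Sum.inr j))) := rfl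

/-- First projection of a lattice tuple of the product. [cite: LangeBirkenhake1992, §5.3] -/
theorem fst_comp_latticeTuple_prodPeriod {k : ℕ} (m : Fin k → (ι₁ ⊕ ι₂ → ℤ)) :
    (ContinuousLinearMap.fst ℝ E₁ E₂) ∘ latticeTuple (prodPeriod Φ₁ Φ₂) m =
      latticeTuple Φ₁ (fun j ↦ fun i ↦ m j (Sum.inl i)) := rfl

/-- Second projection of a lattice tuple of the product. [cite: LangeBirkenhake1992, §5.3] -/
theorem snd_comp_latticeTuple_prodPeriod {k : ℕ} (m : Fin k → (ι₁ ⊕ ι₂ → ℤ)) :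
    (ContinuousLinearMap.snd ℝ E₁ E₂) ∘ latticeTuple (prodPeriod Φ₁ Φ₂) m =
      latticeTuple Φ₂ (fun j ↦ fun i ↦ m j (Sum.inr i)) := rfl

/-- **`pr₁^*` maps `Hᵏ(X₁, ℚ)` into `Hᵏ(X₁ × X₂, ℚ)`.** [cite: HatcherAT2002, §3.2 Thm. 3.16] -/
theorem comp_fst_mem_rationalForms {k : ℕ} {γ : E₁ [⋀^Fin k]→L[ℝ] ℂ} (hγ : γ ∈ rationalForms Φ₁ k) :
    γ.compContinuousLinearMap (ContinuousLinearMap.fst ℝ E₁ E₂) ∈ rationalForms (prodPeriod Φ₁ Φ₂) k :=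
  fun m ↦ by
    obtain ⟨q, hq⟩ := hγ (fun j ↦ fun i ↦ m j (Sum.inl i))
    exact ⟨q, by rw [ContinuousAlternatingMap.compContinuousLinearMap_apply,
      fst_comp_latticeTuple_prodPeriod, hq]⟩

/-- **`pr₂^*` maps `Hᵏ(X₂, ℚ)` into `Hᵏ(X₁ × X₂, ℚ)`.** [cite: HatcherAT2002, §3.2 Thm. 3.16] -/
theorem comp_snd_mem_rationalForms {k : ℕ} {δ : E₂ [⋀^Fin k]→L[ℝ] ℂ} (hδ : δ ∈ rationalForms Φ₂ k) :
    δ.compContinuousLinearMap (ContinuousLinearMap.snd ℝ E₁ E₂) ∈ rationalForms (prodPeriod Φ₁ Φ₂) k :=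
  fun m ↦ by
    obtain ⟨q, hq⟩ := hδ (fun j ↦ fun i ↦ m j (Sum.inr i))
    exact ⟨q, by rw [ContinuousAlternatingMap.compContinuousLinearMap_apply,
      snd_comp_latticeTuple_prodPeriod, hq]⟩

/-- **`pr₁^*` maps Hodge classes to Hodge classes** (`pr₁` is `ℂ`-linear, so types are preserved).
[cite: vanGeemen1994HodgeAV, §2] -/
theorem comp_fst_mem_hodgeClassesIn {k p : ℕ} {γ : E₁ [⋀^Fin k]→L[ℝ] ℂ}
    (hγ : γ ∈ hodgeClassesIn Φ₁ k p) :
    γ.compContinuousLinearMap (ContinuousLinearMap.fst ℝ E₁ E₂) ∈ hodgeClassesIn (prodPeriod Φ₁ Φ₂) k p := by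
  by_cases hk : p + p = k
  · have h := (mem_hodgeClassesIn_iff_isOfTypeAt Φ₁ hk).1 hγ
    exact (mem_hodgeClassesIn_iff_isOfTypeAt _ hk).2
      ⟨comp_fst_mem_rationalForms Φ₁ Φ₂ h.1, h.2.compContinuousLinearMap _ fun _ _ ↦ rfl⟩
  · have h0 : γ = 0 := by
      have := hodgeClassesIn_eq_bot_of_ne Φ₁ hk ▸ hγ
      simpa using this
    have hz : (0 : E₁ [⋀^Fin k]→L[ℝ] ℂ).compContinuousLinearMap (ContinuousLinearMap.fst ℝ E₁ E₂) = 0 := by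
      ext v; rfl
    rw [h0, hz]
    exact Submodule.zero_mem _

/-- **`pr₂^*` maps Hodge classes to Hodge classes.** [cite: vanGeemen1994HodgeAV, §2] -/
theorem comp_snd_mem_hodgeClassesIn {k q : ℕ} {δ : E₂ [⋀^Fin k]→L[ℝ] ℂ}
    (hδ : δ ∈ hodgeClassesIn Φ₂ k q) :
    δ.compContinuousLinearMap (ContinuousLinearMap.snd ℝ E₁ E₂) ∈ hodgeClassesIn (prodPeriod Φ₁ Φ₂) k q := by
  by_cases hk : q + q = k
  · have h := (mem_hodgeClassesIn_iff_isOfTypeAt Φ₂ hk).1 hδ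
    exact (mem_hodgeClassesIn_iff_isOfTypeAt _ hk).2
      ⟨comp_snd_mem_rationalForms Φ₁ Φ₂ h.1, h.2.compContinuousLinearMap _ fun _ _ ↦ rfl⟩
  · have h0 : δ = 0 := by
      have := hodgeClassesIn_eq_bot_of_ne Φ₂ hk ▸ hδ
      simpa using this
    have hz : (0 : E₂ [⋀^Fin k]→L[ℝ] ℂ).compContinuousLinearMap (ContinuousLinearMap.snd ℝ E₁ E₂) = 0 := by
      ext v; rfl
    rw [h0, hz]
    exact Submodule.zero_mem _

/-- **Künneth containment `H^{2p}_Hodge(X₁) ⊗ H^{2q}_Hodge(X₂) → H^{2p+2q}_Hodge(X₁ × X₂)`** (row A4-20):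
the cross product `pr₁^*γ ∧ pr₂^*δ` of Hodge classes of the factors is a Hodge class of the product
(van Geemen §2: `Bᵖ(X) ⊗ B^q(Y) → B^{p+q}(X × Y)`; Lange 2023, §7.3.3 Exercise (3) for products of
elliptic curves). [cite: vanGeemen1994HodgeAV, §2] -/
theorem wedge_comp_fst_snd_mem_hodgeClassesIn {k l p q : ℕ} {γ : E₁ [⋀^Fin k]→L[ℝ] ℂ}
    {δ : E₂ [⋀^Fin l]→L[ℝ] ℂ} (hγ : γ ∈ hodgeClassesIn Φ₁ k p) (hδ : δ ∈ hodgeClassesIn Φ₂ l q) :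
    (γ.compContinuousLinearMap (ContinuousLinearMap.fst ℝ E₁ E₂)).wedge
        (δ.compContinuousLinearMap (ContinuousLinearMap.snd ℝ E₁ E₂)) ∈
      hodgeClassesIn (prodPeriod Φ₁ Φ₂) (k + l) (p + q) :=
  wedge_mem_hodgeClassesIn _ (comp_fst_mem_hodgeClassesIn Φ₁ Φ₂ hγ) (comp_snd_mem_hodgeClassesIn Φ₁ Φ₂ hδ)

/-- The product polarisation class `pr₁^*E₁ + pr₂^*E₂` of two `NS`-classes is a Hodge class of the
product. [cite: Lange2023AbelianVarietiesComplex, §2.4.4 Cor. 2.4.24] -/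
theorem prodForm_mem_hodgeClasses {ω₁ : E₁ [⋀^Fin 2]→L[ℝ] ℝ} {ω₂ : E₂ [⋀^Fin 2]→L[ℝ] ℝ}
    (h₁ : IsNSForm Φ₁ ω₁) (h₂ : IsNSForm Φ₂ ω₂) :
    ofRealForm (prodForm ω₁ ω₂) ∈ hodgeClasses (prodPeriod Φ₁ Φ₂) 1 := by
  have e : ofRealForm (prodForm ω₁ ω₂) =
      (ofRealForm ω₁).compContinuousLinearMap (ContinuousLinearMap.fst ℝ E₁ E₂) +
        (ofRealForm ω₂).compContinuousLinearMap (ContinuousLinearMap.snd ℝ E₁ E₂) := by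
    ext v; simp [prodForm]
  rw [e]
  exact (hodgeClasses _ 1).add_mem (comp_fst_mem_hodgeClassesIn Φ₁ Φ₂ (ofRealForm_mem_hodgeClasses_one Φ₁ h₁))
    (comp_snd_mem_hodgeClassesIn Φ₁ Φ₂ (ofRealForm_mem_hodgeClasses_one Φ₂ h₂))

end Product

/-! ### The elliptic curve `X_τ = ℂ/(ℤτ + ℤ)` -/

section Elliptic

variable {τ : ℂ} (hτ : τ.im ≠ 0)

/-- **`H²_Hodge(X_τ) = H²(X_τ, ℚ)`** for the elliptic curve `X_τ = ℂ/(ℤτ + ℤ)`: every rational class of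
top degree is a Hodge class (`dim_ℂ ℂ = 1`). [cite: Lange2023AbelianVarietiesComplex, §7.3.3 Exercise (2)] -/
theorem hodgeClasses_ellipticPeriod_one_eq :
    hodgeClasses (ellipticPeriod hτ) 1 = rationalForms (ellipticPeriod hτ) (2 * 1) :=
  hodgeClasses_eq_rationalForms_of_finrank_eq _ (Module.finrank_self ℂ)

/-- **`dim_ℚ H²_Hodge(X_τ) = 1`** for the elliptic curve `X_τ = ℂ/(ℤτ + ℤ)` (validation V-A4-2: "`B¹`
of `ℂ/(ℤ+ℤτ)` is all of `H²`, rank `1`"). [cite: Lange2023AbelianVarietiesComplex, §7.3.3 Exercise (2)] -/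
theorem finrank_hodgeClasses_ellipticPeriod_one :
    finrank ℚ (hodgeClasses (ellipticPeriod hτ) 1) = 1 :=
  finrank_hodgeClasses_one_of_finrank_eq_one _ (Module.finrank_self ℂ)

/-- **The principal polarisation class of `X_τ` is a Hodge class**: `E = Im H` with `E(τ, 1) = 1`
(`ellipticForm`, a Riemann form for `Im τ > 0`) lies in `H²_Hodge(X_τ)` and is integral.
[cite: Lange2023AbelianVarietiesComplex, §2.1.1 Example 2.1.3] -/
theorem ellipticForm_mem_hodgeClasses (hτ' : 0 < τ.im) :
    ofRealForm (ellipticForm hτ'.ne') ∈ hodgeClasses (ellipticPeriod hτ'.ne') 1 ∧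
      ofRealForm (ellipticForm hτ'.ne') ∈ integralForms (ellipticPeriod hτ'.ne') 2 :=
  ⟨ofRealForm_mem_hodgeClasses_one_of_isRiemannForm _ (isRiemannForm_ellipticForm hτ'),
    ofRealForm_mem_integralForms_two _ (isRiemannForm_ellipticForm hτ').isNSForm⟩

end Elliptic

end ComplexTorus

end Literature.Geometry.Kaehler

end
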